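import Summits.CriticalPhenomena.CardyFormulaZ2.Theses.CardySelfRefinement

/-!
# Disproof of `TrivialSectorRate` (stmt-CriticalPhenomena-10266) — standing adversary file

Refuter `refuter-cdisprove-stmt-CriticalPhenomena-10266-0`, route CardySelfRefinement, 2026-08-15.
Verdict so far: the crux RESISTS; no `_refuted` theorem is possible in Lean today (§2) and the
physics-level kill scenario recorded by the planner is void (§4).  Index:

* §1 `trivialSectorRate_iff`, `criticalPathRSW_iff` — the crux and its sibling unfolded DEFINITIONALLY
  over named data (`cfg`, `prm`, `M`, `A`, `P`, `Dρ`, `Dc`) and the sets `admissiblePaths k`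
  (= the route's `PathOK k`), `conclSet k m F` (= its conclusion).  (`if (k:ℤ) ∣ …` is inlined so the
  `ite`s carry `Int.decidableDvd` exactly as in the route term; a `def ax … : Prop` would elaborate
  `Classical.propDecidable` and break the `Iff.rfl`.)
* §2 LOAD-BEARING / VACUITY: `trivialSectorRate_of_no_admissiblePath` — with no RSW path (k = 2, 3) the
  crux is vacuously TRUE; `exists_admissiblePath_of_not_trivialSectorRate`,
  `hasBoxCrossingProperty_endpoints_of_not_trivialSectorRate` — any refutation CONSTRUCTS an RSW path and
  hence proves the box-crossing property of `M k 1 0` (bond-kℤ² with collinear sub-edges) and of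
  `M k 0 (1/2)` (all edges i.i.d. fair = critical bond-ℤ²).  RSW for bond-ℤ² is not a theorem of the tree,
  so `¬ TrivialSectorRate` is not closable in Lean before it is — the reason there is no `_refuted` here.
* §3 KILL SWITCH: `endpointParallel_of_trivialSectorRate` — along any admissible path the crux pins a
  PATH-FREE statement at the two endpoints all paths share, `(1,0) ∈ endpointParallel k` and
  `(0,½) ∈ endpointParallel k`; `not_trivialSectorRate_of_endpoint_failure(_coarse)` —
  `CriticalPathRSW → (0,½) ∉ endpointParallel k → ¬ TrivialSectorRate` (k = 2 or 3).  So the route ENGINE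
  (TSR ∧ CriticalPathRSW) is refutable by an estimate on plain critical bond-ℤ² alone: the two Russo
  class sums `Dρ`, `Dc` at (ρ,c) = (0,½) must be parallel to ONE direction up to an ABSOLUTE O(η^θ).
  §5 measures exactly this.
* §4 WHY IT RESISTS (physics; details in the second docblock below): both Russo insertions are zero-mean
  functions of ONE independent coin, so their mutual two-point functions vanish identically; since
  ⟨ψ̃ψ̃⟩ ∋ (4√3/π)·log r · r^{-5/2} ≠ 0 for the logarithmic partner ψ̃ of the energy operator
  (Vasseur–Jacobsen–Saleur 2012, arXiv:1206.2312 §4: ψ̃(Λr) = Λ^{-5/4}(ψ̃(r) + (2√3/π) log Λ · ε(r)),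
  while ε itself is a pure eigenvector), coin insertions have NO ψ̃ component: they couple only to the
  null sector {ε, T, T̄, descendants, φ_{1,3}, …} where scaling is a pure power.  Null fields with x < 2:
  𝟙 (coefficient exactly 0, mass conservation) and ε (defines κ(s)); T, T̄ at x = 2 enter at ABSOLUTE
  order η⁰ ('gap exactly 3/4') and cancel EXACTLY because each insertion class is invariant under the
  p4m symmetry of M_k about coarse vertices and cell centres (all members of a class carry the same
  parameter, at every (ρ,c)).  First surviving corrections: quad boundary layers O(η) (half-plane
  3-arm exponent 2), a possible null 6-leg partner O(η^{11/12}), ∂∂̄ε O(η^{5/4}).  Heuristic value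
  θ = min(1, θ₀ − 3/4) ≈ 11/12 > 0: the crux is physically consistent; open is only its proof
  (GPS13, arXiv:1008.1378 §3/§5: unquantified coupling exponent) and universality along M_k(γ(s)).
  Consequences for planners: (a) a one-orientation / one-sub-class variant of the crux is FALSE at the
  physics level (T survives: error Θ(1)) — the D₄ class sums are load-bearing at absolute order;
  (b) at s = 0 the bulk coupling of the interior-edge insertion vanishes (a lone interior edge is
  dangling at c = 0), Dc(1,0) = O(η) is a boundary-contact term, absorbed by κ(0) ∝ (1,0), and
  c_ε(int; s) ≈ 3 c(s) C₁ → 0 continuously (k = 2); (c) dropping the RSW clause of PathOK gives no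
  counterexample (off-critical points satisfy the conclusion trivially; near-critical crossover keeps
  the ε-direction) — so no `_false_without_RSW` exists even heuristically; (d) m = 0 and exponentially
  trivial quad families satisfy the conclusion trivially (the per-F ∃θ has slack).
* §5 COMPUTATION — RESULT: the endpoint statement `(0,½) ∈ endpointParallel k` (k = 2, 3) is numerically
  CONFIRMED, with the predicted rate.  Kit jobs (evidence `compute-<id>.json` on the item): j013965 (n = 4–12 +
  exact self-tests), j013966 (16–32), j013967/j013968 (48–96), j013969/j014697 (128), j013970/j014698/j014699
  (192, 256); bundle `mc/main.py` + `mc/run.sh`; combined table `mc/analysis_final.txt` (attached).  Method: plain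
  critical bond-ℤ², box {0..n}², both crossing orientations, η = 1/n; exact Russo identities at (ρ,c) = (0,½):
  Dc = Σ_{f interior} P(f pivotal) (estimator X̂ = 2·#closed interior pivotal), Dρ = Σ_E Σ_x δ_k(x) E[1_A | x]
  (estimator Ŷ = 2^k Σ_{E all closed} Σ_x δ_k(x) 1_A(x), two-group patterns merged through pre-existing clusters),
  VALIDATED in-job by exact enumeration of ∂_ρP, ∂_cP on the 2×2 box (k = 2: Dρ = 0.15625, Dc = 0.71875) and the
  3×3 box (k = 3: Dρ = 0.239273071289, Dc = 1.447204589844), estimator = polynomial to 1e-12, plus brute force.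
  Samples: 6.8e7 (n=4) … 1.7e6 (n=128), 5.9e5 (192), 3.1e5 (256).
  R₂(n) = Dρ/Dc: 0.128158(33) 0.102390(32) 0.091187(35) 0.081833(36) 0.077809(41) 0.074615(46) 0.073236(48)
  [n = 4 6 8 12 16 24 32]; 0.072375(57) 0.071959(64) 0.071608(77) 0.071452(46) 0.071583(68) 0.071390(83)
  [n = 48 64 96 128 192 256].  Fit R₂ = κ + A n^{-p}: n ≥ 12: p = 1.70 [1.675,1.70], κ = 0.07134 (χ² 13/7);
  n ≥ 16: p = 1.725 [1.70,1.75], κ = 0.07135; n ≥ 24: p = 1.80 [1.725,1.90]; log-drift / constant fits are worse by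
  χ² factors 10²–10⁵.  k = 3 (n = 6…192): κ₃ = 0.0558, p = 1.70 [1.675,1.70].  Pair diagnostic
  S(n) = [R₂(n) − R₂(2n)] n^{3/4} = 0.105, 0.079, 0.064, 0.047, 0.037, 0.024, 0.017, 0.014, 0.011, 0.001(3) → 0.
  HENCE |Dρ − κ Dc| ≈ 0.7·Dc·n^{-1.72} = O(η^{0.97}): θ ≈ 0.95 ≈ 11/12 and θ₀ = p ≈ 1.7 ∈ [5/3, 7/4] — exactly the
  null-6-leg/boundary prediction of §4 and the planner's bet; the kill criterion θ₀ ≤ 3/4 fails by a factor > 2.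
  CONTROLS (all as predicted in §4): Dc ∝ n^{0.74}; orientation differences are CONSTANT at absolute order n⁰ —
  Y_par − Y_perp = 0.1629 … 0.1664(1) (fitted exponent 0.009), X_par − X_perp(axial) → 0.945 — the stress-tensor
  (spin-2) term; the ONE-ORIENTATION ratios Y_par/X_par = 0.0745 and Y_perp/X_perp = 0.0681 at n = 256 approach
  κ = 0.0714 from opposite sides like n^{-3/4}, i.e. the one-orientation variant of the crux has an O(1) absolute
  defect and is FALSE, while the D₄ class sum converges with θ ≈ 1.  No logarithmic drift anywhere.
  Limits of the test: one quad family (the square, both orientations), the s = 1 endpoint only (the interior of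
  the path and the dependent models M_k(γ(s)) are untested), n ≤ 256.
* §6 Near-misses sorried: none.  Dead ends: see §4 (c), (d).
-/

/-!
## Physics record, longer form (for provers)

Russo bookkeeping.  `∂_c P = Σ_{f interior} (E[1_A | f open] − E[1_A | f closed])`;
`∂_ρ P = Σ_{E coarse} Σ_{x ∈ {0,1}^k} δ_k(x) E[1_A | sub-edges(E) = x]`.  For k = 2 this is
`¼ Δ_{e₁}Δ_{e₂} P = ¼ (P(AND_E) − P(OR_E))`, AND_E = {u ~ ∂₀, v ~ ∂₂, w ~ neither} ∪ swap,
OR_E = {w ~ ∂₀; u, v ~ ∂₂} ∪ swap (u–w–v the three vertices of E, connectivity in the other edges):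
two 4-arm-type seeds, so the GPS13 ratio-limit theorem gives parallelism of (Dρ, Dc) with SOME
relative power saving η^{θ_GPS}; the crux is `θ_GPS > 3/4 after class symmetrisation`.

Null-sector argument.  Write the insertion as E[1_A · O] with O a zero-mean function of one coin.
⟨O(0) O(r)⟩ ≡ 0 (independence).  In the c = 0 LCFT, O = α ψ̃ + β ε + (x ≥ 2 fields); the r^{-5/2} log r
term of ⟨OO⟩ has coefficient ∝ α², so α = 0.  The same argument removes every non-null field
(2-, 3-, 6-leg watermelons, subleading magnetic x = 77/48, the spin-1 4-leg fields (2,±½) at 23/16).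
The pairing ⟨A| · ⟩ with a macroscopic crossing functional is, by topology, supported on ≥4-arm states,
consistent with ε being the lowest non-identity null field (x = 5/4 = 4-arm exponent).  Scaling of
null eigenvectors is pure power (VJS12: ε(Λr) = Λ^{-5/4} ε(r); T likewise), consistent with the clean
η^{-3/4} of Russo sums and with GPS13's power-rate ratio limits.

Orders after Σ_x (η^{-2}): ε → η^{-3/4}; T, T̄ → η⁰ (cancelled by Z₄ ⊂ p4m: spin 2 ↦ −1 under the quarter
turn about a coarse vertex / cell centre, both symmetry centres of M_k for k = 2, 3); ∂ε → η^{1/4}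
(spin 1, cancelled); ∂∂̄ε → η^{5/4}; TT̄, φ_{1,3} → η²; boundary layer of ∂Q → η¹ (for an arbitrary
simply connected quad Beurling's estimate still gives a polynomially small layer); marked points → η¹.

Strategic consequence for PROVERS.  The rate θ₀ > 3/4 exists only AFTER exact signed cancellation
(null structure + Z₄ projection).  A total-variation coupling of conditional laws given two seeds
(GPS13 Prop. 11/15, arXiv:1008.1378 p.21: 'some absolute exponent k > 0'; p.21 L37: adapts to bond-ℤ²)
is seed-by-seed and blind to cancellations BETWEEN the seeds of a class, so its exponent is capped by
the smallest gap of the 4-arm annulus chain over ALL symmetry sectors.  The 2-propagating-cluster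
(= 4-leg) sector of the Potts CFT is F_{2,1} ⊕ F_{2,−1} (Jacobsen–Saleur, arXiv:1809.02191 §5.2.3 p.18):
weights (h_{e,−2}; h_{e,2}), e ∈ ℤ (symmetric part 2S, even spins) and (h_{e+½,−2}; h_{e+½,2}) (antisymmetric
part 2A, odd spins), ALL with non-vanishing amplitudes in the scaling limit (§5.2.4, 'absolutely no
evidence' of decoupling).  At c = 0: 2S = {x = 5/4 (e = 0), x = 2 spin ±2 (e = ±1: the stress-tensor
partner t), 17/4 spin ±4, …}; 2A = {x = 23/16 spin ±1 (e = 0, −1), 47/16 spin ±3, …}.  So a TV coupling has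
exponent ≤ 3/16 for generic seeds and ≤ 3/4 for π-symmetric ones — never > 3/4.  Hence no refinement of
the GPS coupling can prove the crux; a proof must be LINEAR — an eigen-expansion of Kesten's 4-arm
annulus transfer operator (card annulus-transfer-sector-gaps / route CardySectorGap) with the Z₄-trivial
projection applied before taking absolute values (Z₂ = rotation by π already kills 2A; the quarter turn
kills the spin-2 states of 2S), plus an argument that coin insertions see only the null eigenvector at
x = 5/4 (the probabilistic shadow of ⟨O O'⟩ ≡ 0).  Each single insertion of the crux (an interior edge; a
collinear pair/triple) is already π-symmetric about its midpoint, so even the un-symmetrised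
one-orientation sums carry no η^{3/16−3/4}-type term — their first non-parallel term is T at absolute
order η⁰, which is what makes the one-orientation variant false and the full class sums necessary.
-/

namespace Summit.CriticalPhenomena.CardyFormulaZ2.Cruxes.TrivialSectorRate.Disproof

open scoped BigOperators Topology Classical MeasureTheory ProbabilityTheory Matrix
open Filter Set Function TopologicalSpace MeasureTheory
open Literature.Probability.LatticeModels Literature.Probability.Percolation
open Summit.CriticalPhenomena.CardyFormulaZ2.Theses.CardySelfRefinement

/-! ## §1 The route's `let`-chain as named data and sets (verbatim bodies) -/

/-- `cfg k S`: the bond configuration induced by the coin set `S` (own coin type 0, shared coin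
type 1, selector type 2; blocks by Euclidean division; an edge on a line of `kℤ²` follows the shared
coin iff its block's selector is on). [folklore] -/
def cfg (k : ℕ) (S : Set (Site 2 × Fin 2 × Fin 3)) : BondConfig (Site 2) :=
  {e | ∃ (v : Site 2) (d : Fin 2), e = s(v, v + (if d = 0 then ![1, 0] else ![0, 1])) ∧
    (if (k : ℤ) ∣ (v, d).1 (if (v, d).2 = 0 then 1 else 0) then
      (((fun i => (v, d).1 i / (k : ℤ)), (v, d).2, (2 : Fin 3)) ∈ S ∧
        ((fun i => (v, d).1 i / (k : ℤ)), (v, d).2, (1 : Fin 3)) ∈ S) ∨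
      (((fun i => (v, d).1 i / (k : ℤ)), (v, d).2, (2 : Fin 3)) ∉ S ∧ ((v, d).1, (v, d).2, (0 : Fin 3)) ∈ S)
    else ((v, d).1, (v, d).2, (0 : Fin 3)) ∈ S)}

/-- `prm k ρ c`: coin parameters (own coin ½ on the lines of `kℤ²`, `c` elsewhere; shared ½;
selector `ρ`; clamped by `projIcc`). [folklore] -/
noncomputable def prm (k : ℕ) (ρ c : ℝ) (i : Site 2 × Fin 2 × Fin 3) : unitInterval :=
  if i.2.2 = 0 then
    (if (k : ℤ) ∣ (i.1, i.2.1).1 (if (i.1, i.2.1).2 = 0 then 1 else 0) then half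
      else Set.projIcc (0 : ℝ) 1 zero_le_one c)
  else if i.2.2 = 1 then half else Set.projIcc (0 : ℝ) 1 zero_le_one ρ

/-- `M k ρ c`: the self-refinement interpolation measure on bond configurations of ℤ². [folklore] -/
noncomputable def M (k : ℕ) (ρ c : ℝ) : Measure (BondConfig (Site 2)) :=
  (prodBernoulli (prm k ρ c)).map (cfg k)

/-- `A m F η`: every quad of the family `F` is crossed at mesh `η`. [folklore] -/
def A (m : ℕ) (F : Fin m → QuadCrossing.Quad (Set.univ : Set ℂ)) (η : ℝ) : Set (BondConfig (Site 2)) :=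
  {ω | ∀ i, F i ∈ QuadCrossing.configOf squareLatticeEmbedding.z η Set.univ ω}

/-- `P k m F η ρ c`: the joint crossing probability. [folklore] -/
noncomputable def P (k : ℕ) (m : ℕ) (F : Fin m → QuadCrossing.Quad (Set.univ : Set ℂ)) (η ρ c : ℝ) : ℝ :=
  (M k ρ c).real (A m F η)

/-- `Dρ`: Russo derivative in the selector parameter, within `[0,1]`. [folklore] -/
noncomputable def Dρ (k : ℕ) (m : ℕ) (F : Fin m → QuadCrossing.Quad (Set.univ : Set ℂ)) (η : ℝ)
    (q : ℝ × ℝ) : ℝ :=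
  derivWithin (fun ρ' => P k m F η ρ' q.2) (Set.Icc 0 1) q.1

/-- `Dc`: Russo derivative in the interior-edge parameter, within `[0,1]`. [folklore] -/
noncomputable def Dc (k : ℕ) (m : ℕ) (F : Fin m → QuadCrossing.Quad (Set.univ : Set ℂ)) (η : ℝ)
    (q : ℝ × ℝ) : ℝ :=
  derivWithin (fun c' => P k m F η q.1 c') (Set.Icc 0 1) q.2

/-- `admissiblePaths k` (= the route's `PathOK k`): continuous BV paths from (1,0) to (0,½) in the unit
square along which `M k` has box-crossing bounds uniform in the parameter. [folklore] -/
def admissiblePaths (k : ℕ) : Set (unitInterval → ℝ × ℝ) :=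
  {γ | Continuous γ ∧ γ 0 = (1, 0) ∧ γ 1 = (0, 1 / 2) ∧ (∀ s, γ s ∈ Set.Icc (0 : ℝ) 1 ×ˢ Set.Icc (0 : ℝ) 1) ∧
    BoundedVariationOn (fun s => (γ s).1) Set.univ ∧ BoundedVariationOn (fun s => (γ s).2) Set.univ ∧
    ∀ a : ℝ, 0 < a → ∃ c₀ > 0, ∃ n₀ : ℕ, ∀ s,
      BoxCrossingBounds (M k (γ s).1 (γ s).2) squareLatticeEmbedding.z a c₀ n₀}

/-- `conclSet k m F`: the paths along which the crux's conclusion holds for the family `F`. [folklore] -/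
def conclSet (k : ℕ) (m : ℕ) (F : Fin m → QuadCrossing.Quad (Set.univ : Set ℂ)) : Set (unitInterval → ℝ × ℝ) :=
  {γ | ∃ θ : ℝ, 0 < θ ∧ ∃ κ₁ κ₂ : unitInterval → ℝ, Continuous κ₁ ∧ Continuous κ₂ ∧ (∀ s, κ₁ s ≠ 0 ∨ κ₂ s ≠ 0) ∧
    ∃ C η₀ : ℝ, 0 < η₀ ∧ ∀ s : unitInterval, ∀ η ∈ Set.Ioo 0 η₀,
      |κ₂ s * Dρ k m F η (γ s) - κ₁ s * Dc k m F η (γ s)| ≤ C * η ^ θ}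

/-- The crux is literally `∀ k ∈ {2,3}, ∀ γ ∈ admissiblePaths k, ∀ m F, γ ∈ conclSet k m F`
(definitional unfolding of the route's `let`-chain). [folklore] -/
theorem trivialSectorRate_iff :
    TrivialSectorRate ↔ ∀ k : ℕ, k = 2 ∨ k = 3 → ∀ γ ∈ admissiblePaths k,
      ∀ (m : ℕ) (F : Fin m → QuadCrossing.Quad (Set.univ : Set ℂ)), γ ∈ conclSet k m F := by
  unfold TrivialSectorRate
  exact Iff.rfl

/-- The sibling crux `CriticalPathRSW` is literally `∀ k ∈ {2,3}, (admissiblePaths k).Nonempty`. [folklore] -/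
theorem criticalPathRSW_iff :
    CriticalPathRSW ↔ ∀ k : ℕ, k = 2 ∨ k = 3 → (admissiblePaths k).Nonempty := by
  unfold CriticalPathRSW
  exact Iff.rfl

/-! ## §2 Load-bearing analysis: vacuity without a path; what a refutation must contain -/

/-- VACUITY DIRECTION: with no admissible RSW path for k = 2, 3 the crux holds vacuously. [folklore] -/
theorem trivialSectorRate_of_no_admissiblePath
    (h : ∀ k : ℕ, k = 2 ∨ k = 3 → admissiblePaths k = ∅) : TrivialSectorRate :=
  trivialSectorRate_iff.2 fun k hk γ hγ => by simp [h k hk] at hγ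

/-- Any refutation of the crux exhibits an admissible RSW path for k = 2 or k = 3. [folklore] -/
theorem exists_admissiblePath_of_not_trivialSectorRate (h : ¬ TrivialSectorRate) :
    ∃ k : ℕ, (k = 2 ∨ k = 3) ∧ (admissiblePaths k).Nonempty := by
  by_contra hne
  refine h (trivialSectorRate_of_no_admissiblePath fun k hk => ?_)
  exact Set.not_nonempty_iff_eq_empty.1 fun hn => hne ⟨k, hk, hn⟩

/-- … and therefore proves the box-crossing (RSW) property of BOTH endpoint models `M k 1 0`
(bond-kℤ² drawn with k collinear sub-edges, interior closed) and `M k 0 (1/2)` (every edge an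
independent fair coin = critical bond-ℤ²).  Neither is a theorem of the tree (2026-08-15). [folklore] -/
theorem hasBoxCrossingProperty_endpoints_of_not_trivialSectorRate (h : ¬ TrivialSectorRate) :
    ∃ k : ℕ, (k = 2 ∨ k = 3) ∧
      HasBoxCrossingProperty (M k 1 0) squareLatticeEmbedding.z ∧
      HasBoxCrossingProperty (M k 0 (1 / 2)) squareLatticeEmbedding.z := by
  obtain ⟨k, hk, γ, hγ⟩ := exists_admissiblePath_of_not_trivialSectorRate h
  obtain ⟨_, h0, h1, _, _, _, hrsw⟩ := hγ
  refine ⟨k, hk, ?_, ?_⟩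
  · intro a ha
    obtain ⟨c₀, hc₀, n₀, hn⟩ := hrsw a ha
    exact ⟨c₀, hc₀, n₀, by simpa [h0] using hn 0⟩
  · intro a ha
    obtain ⟨c₀, hc₀, n₀, hn⟩ := hrsw a ha
    exact ⟨c₀, hc₀, n₀, by simpa [h1] using hn 1⟩

/-! ## §3 Kill switch: the path-free endpoint statements -/

/-- `endpointParallel k`: the parameter points `q` at which, for every finite quad family, the Russo
gradient `(Dρ, Dc)` at mesh `η` is parallel to ONE fixed non-zero direction `(a, b)` up to an absolute
`O(η^θ)`.  At `q = (0, ½)`: a statement about plain critical bond-ℤ² only (`Dc` = Σ of pivotal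
probabilities over the edges off the lines of `kℤ²`; `Dρ` = Σ over coarse edges of
`Σ_x (½[x const] − 2^{-k}) E[1_A | sub-edges = x]`).  At `q = (1, 0)`: bond-kℤ² (`Dc` a pure
boundary-contact term, `Dρ` a bulk 4-arm sum). [folklore] -/
def endpointParallel (k : ℕ) : Set (ℝ × ℝ) :=
  {q | ∀ (m : ℕ) (F : Fin m → QuadCrossing.Quad (Set.univ : Set ℂ)),
    ∃ θ : ℝ, 0 < θ ∧ ∃ a b : ℝ, (a ≠ 0 ∨ b ≠ 0) ∧ ∃ C η₀ : ℝ, 0 < η₀ ∧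
      ∀ η ∈ Set.Ioo 0 η₀, |b * Dρ k m F η q - a * Dc k m F η q| ≤ C * η ^ θ}

/-- The crux, applied along any admissible path, pins the two shared endpoints. [folklore] -/
theorem endpointParallel_of_trivialSectorRate (h : TrivialSectorRate) {k : ℕ} (hk : k = 2 ∨ k = 3)
    {γ : unitInterval → ℝ × ℝ} (hγ : γ ∈ admissiblePaths k) :
    ((1 : ℝ), (0 : ℝ)) ∈ endpointParallel k ∧ ((0 : ℝ), (1 / 2 : ℝ)) ∈ endpointParallel k := by
  have h0 : γ 0 = (1, 0) := hγ.2.1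
  have h1 : γ 1 = (0, 1 / 2) := hγ.2.2.1
  have hc := trivialSectorRate_iff.1 h k hk γ hγ
  constructor
  · intro m F
    obtain ⟨θ, hθ, κ₁, κ₂, _, _, hne, C, η₀, hη₀, hb⟩ := hc m F
    exact ⟨θ, hθ, κ₁ 0, κ₂ 0, hne 0, C, η₀, hη₀, fun η hη => by simpa [h0] using hb 0 η hη⟩
  · intro m F
    obtain ⟨θ, hθ, κ₁, κ₂, _, _, hne, C, η₀, hη₀, hb⟩ := hc m F
    exact ⟨θ, hθ, κ₁ 1, κ₂ 1, hne 1, C, η₀, hη₀, fun η hη => by simpa [h1] using hb 1 η hη⟩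

/-- ROUTE-ENGINE KILL SWITCH.  Given the sibling crux `CriticalPathRSW`, failure of the path-free
plain-percolation statement `(0, ½) ∈ endpointParallel k` (k = 2 or 3) refutes the crux: the engine
`TrivialSectorRate ∧ CriticalPathRSW` is refutable by an estimate on critical bond-ℤ² ALONE. [folklore] -/
theorem not_trivialSectorRate_of_endpoint_failure (hpath : CriticalPathRSW) {k : ℕ} (hk : k = 2 ∨ k = 3)
    (hfail : ((0 : ℝ), (1 / 2 : ℝ)) ∉ endpointParallel k) : ¬ TrivialSectorRate := by
  intro h
  obtain ⟨γ, hγ⟩ := criticalPathRSW_iff.1 hpath k hk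
  exact hfail (endpointParallel_of_trivialSectorRate h hk hγ).2

/-- Same at the coarse endpoint `(1, 0)`. [folklore] -/
theorem not_trivialSectorRate_of_endpoint_failure_coarse (hpath : CriticalPathRSW) {k : ℕ}
    (hk : k = 2 ∨ k = 3) (hfail : ((1 : ℝ), (0 : ℝ)) ∉ endpointParallel k) : ¬ TrivialSectorRate := by
  intro h
  obtain ⟨γ, hγ⟩ := criticalPathRSW_iff.1 hpath k hk
  exact hfail (endpointParallel_of_trivialSectorRate h hk hγ).1

/-- Conversely the kill switch is the ONLY content the endpoints add: if both crux and sibling hold,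
both endpoint statements hold for k = 2 and k = 3. [folklore] -/
theorem endpointParallel_of_engine (h : TrivialSectorRate) (hpath : CriticalPathRSW) {k : ℕ}
    (hk : k = 2 ∨ k = 3) :
    ((1 : ℝ), (0 : ℝ)) ∈ endpointParallel k ∧ ((0 : ℝ), (1 / 2 : ℝ)) ∈ endpointParallel k := by
  obtain ⟨γ, hγ⟩ := criticalPathRSW_iff.1 hpath k hk
  exact endpointParallel_of_trivialSectorRate h hk hγ

end Summit.CriticalPhenomena.CardyFormulaZ2.Cruxes.TrivialSectorRate.Disproof
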